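import Literature.Topology.FourManifolds.FlowerSectorWord
import HarnessLib

/-!
# The reflection of `ℝ³` on the basis loops of the flower sector

Topic `Literature/Topology/FourManifolds`; `π₁`-bookkeeping (W2) brick of the Dehn–Nielsen–Baer seat
(`DehnNielsenBaerSurface.lean`).  Among the realised classes of
`dehnNielsenBaerSurfaceSmooth_of_flower_generators_symm` is the reflection `σ = refl3`
(`(x, y, z) ↦ (x, -y, z)`); to write `σ_#` on the melon marking (`FlowerMarkingValues.lean`) one
needs `σ` on the two basis loops `loopR (0, false)` (the `C₁`-arc loop, generator `a`) and
`loopR (0, true)` (the lens-arc loop, generator `b`) of the standard sector at the base point `P`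
(`FlowerSectorWord.exists_basis_loopR`).  This file proves the POINTWISE facts:

* `refl3_lift_add_smul_ez`, `refl3_arcCFun`, `refl3_arcC` — the `C₁`-arc lies in the plane `y = 0`
  and is fixed pointwise; `refl3_arcLFun`, `refl3_arcL_apply` — the lens arc is reversed
  (`x ↦ -x`); `refl3_approachC`, `refl3_approachL` — the approach paths to the `C₁`-arc are fixed,
  those to the lens arc are exchanged;
* `map_refl3_loopR_false` — **`σ ∘ loopR a = loopR a`** (equality of paths, after the cast
  along `σ(P) = P`);
* `map_refl3_loopR_true` — **`σ ∘ loopR b` is the reverse loop `(loopR b)⁻¹` up to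
  reassociation**: on `π₁(sector, P)`, `σ_# θ(a) = θ(a)` and `σ_# θ(b) = θ(b)⁻¹`
  (`cl_map_refl3_loopR_false/_true`, in the homotopy quotient of the sector; the ambient-`𝔼 3`
  homotopy `homotopic_map_refl3_loopR_true` is trivially true there and deprecated).

Everything is proved; no definitions, no named facts (D-0026).

## References

* B. Farb, D. Margalit, *A primer on mapping class groups* (2012), Thm. 8.1. [FarbMargalit2012]
* H. Zieschang, E. Vogt, H.-D. Coldewey, *Surfaces and Planar Discontinuous Groups*, LNM 835 (1980),
  §3.2 (the reflection of the canonical polygon on the canonical generators). [ZieschangVogtColdewey1980]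
* A. Hatcher, *Algebraic Topology* (2002), §1.1. [HatcherAT2002]
-/

open scoped Topology Real unitInterval
open Set Function Metric

noncomputable section

namespace Literature.Topology.FourManifolds

/-- Local notation: `𝔼 n` is the model Euclidean space `EuclideanSpace ℝ (Fin n)`. -/
local notation "𝔼 " n:arg => EuclideanSpace ℝ (Fin n)

open PlanarThickening PlanarDouble Literature.AlgebraicTopology.Homotopy
  Literature.AlgebraicTopology.FundamentalGroup

namespace FlowerModel

variable {g : ℕ}

/-! ### §1 The reflection on the arcs and the approach paths -/

/-- `σ (u + h e_z) = σ(u) + h e_z` for planar `u`. [folklore] -/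
theorem refl3_lift_add_smul_ez (u : 𝔼 2) (h : ℝ) : refl3 (lift u + h • ez) = lift (refl u) + h • ez := by
  rw [refl3_apply, map_add, map_smul, proj_lift, proj_ez, smul_zero, add_zero]
  congr 2
  simp

/-- The `C₁`-arc is fixed pointwise by `σ` (it lies in the plane `y = 0`). [folklore] -/
theorem refl3_arcCFun (hg : 2 ≤ g) (x : ℝ) : refl3 (arcCFun hg x) = arcCFun hg x := by
  rcases le_or_gt x 0 with hx | hx
  · rw [arcCFun_of_le hg hx, refl3_lift_add_smul_ez, refl_ax]
  · rw [arcCFun_of_ge hg hx.le, refl3_lift_add_smul_ez, refl_ax]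

/-- The `C₁`-arc is fixed pointwise by `σ`. [folklore] -/
@[simp] theorem refl3_arcC (hg : 2 ≤ g) (x : closedBall (0 : ℝ) 1) : refl3 (arcC hg x) = arcC hg x :=
  refl3_arcCFun hg x.1

/-- The radius of the lens arc is even. [folklore] -/
theorem radL_neg (hg : 2 ≤ g) (x : ℝ) : radL hg (-x) = radL hg x := by
  simp [radL, abs_neg]

/-- `σ` reverses the lens arc: `σ (arcL x) = arcL (-x)`. [folklore] -/
theorem refl3_arcLFun (hg : 2 ≤ g) (x : ℝ) : refl3 (arcLFun hg x) = arcLFun hg (-x) := by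
  rcases le_or_gt x 0 with hx | hx
  · rw [arcLFun_of_le hg hx, arcLFun_of_ge hg (neg_nonneg.2 hx), refl3_lift, refl_pol, radL_neg]
  · rw [arcLFun_of_ge hg hx.le, arcLFun_of_le hg (neg_nonpos.2 hx.le), refl3_lift, refl_pol, neg_neg,
      radL_neg]

/-- The point `-x` of the closed unit ball of `ℝ`. [folklore] -/
theorem neg_mem_closedBall_zero_one {x : ℝ} (hx : x ∈ closedBall (0 : ℝ) 1) : -x ∈ closedBall (0 : ℝ) 1 := by
  rw [mem_closedBall, dist_zero_right, Real.norm_eq_abs] at hx ⊢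
  rwa [abs_neg]

/-- `σ` reverses the lens arc. [folklore] -/
theorem refl3_arcL_apply (hg : 2 ≤ g) (x : closedBall (0 : ℝ) 1) :
    refl3 (arcL hg x) = arcL hg ⟨-x.1, neg_mem_closedBall_zero_one x.2⟩ :=
  refl3_arcLFun hg x.1

/-- The approach paths to the `C₁`-arc are fixed pointwise by `σ`. [folklore] -/
theorem refl3_approachC (hg : 2 ≤ g) (sg : ℝ) (hσ : sg = 1 ∨ sg = -1) (t : I) :
    refl3 (approachC hg sg hσ t) = approachC hg sg hσ t := by
  have h : approachC hg sg hσ t = lift (ax (radA g t)) + (sg * Real.sqrt (level g - prof g (radA g t))) • ez :=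
    rfl
  rw [h, refl3_lift_add_smul_ez, refl_ax]

/-- `σ` exchanges the two approach paths to the lens arc. [folklore] -/
theorem refl3_approachL (hg : 2 ≤ g) (sg sg' : ℝ) (hσ : sg = 1 ∨ sg = -1) (hσ' : sg' = 1 ∨ sg' = -1)
    (hs : sg' = -sg) (t : I) : refl3 (approachL hg sg hσ t) = approachL hg sg' hσ' t := by
  have h₁ : approachL hg sg hσ t = lift (pol (radB hg t) (sg * thlo g (radB hg t))) := rfl
  have h₂ : approachL hg sg' hσ' t = lift (pol (radB hg t) (sg' * thlo g (radB hg t))) := rfl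
  rw [h₁, h₂, refl3_lift, refl_pol, hs, neg_mul]

/-! ### §2 The reflection on the basis loops -/

/-- The core `hh` of the arcs is `s ↦ 1 - 2s`. [folklore] -/
theorem hh_apply (s : I) : (hh s : ℝ) = 1 - 2 * s := by
  rw [hh, Path.trans_apply]
  split_ifs with h
  · rw [hIn_apply]
  · rw [hOut_apply]
    push_cast
    ring

/-- The core run backwards is the core negated: `hh (1 - s) = -hh s`. [folklore] -/
theorem hh_symm_apply (s : I) : (hh (unitInterval.symm s) : ℝ) = -(hh s : ℝ) := by
  rw [hh_apply, hh_apply, unitInterval.coe_symm_eq]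
  ring

/-- **`σ ∘ loopR a = loopR a`**: the `a`-loop of the sector lies in the plane `y = 0`.
[cite: ZieschangVogtColdewey1980, §3.2] -/
theorem map_refl3_loopR_false (hg : 2 ≤ g) (j : Fin 1) :
    ((loopR hg (j, false)).map refl3.continuous).cast (refl3_ptP g).symm (refl3_ptP g).symm =
      loopR hg (j, false) := by
  apply Path.ext
  rw [Path.cast_coe, Path.map_coe]
  funext t
  rw [comp_apply, loopR]
  simp only [Path.trans_apply]
  split_ifs with h₁ h₂
  · exact refl3_approachC hg (-1) (Or.inr rfl) _
  · show refl3 (arcs hg (j, false) (hh _)) = arcs hg (j, false) (hh _)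
    rw [arcs_false, refl3_arcC]
  · exact refl3_approachC hg 1 (Or.inl rfl) _

/-- **`σ ∘ loopR b`, computed**: it is `apprMinus b · (s ↦ arcL (-(hh s))) · (apprPlus b)⁻¹`, i.e.
the reverse loop reassociated: `σ ∘ loopR b = (apprMinus b · (core)⁻¹) · (apprPlus b)⁻¹` while
`(loopR b)⁻¹ = apprMinus b · ((core)⁻¹ · (apprPlus b)⁻¹)`. [cite: ZieschangVogtColdewey1980, §3.2] -/
theorem map_refl3_loopR_true (hg : 2 ≤ g) (j : Fin 1) :
    ((loopR hg (j, true)).map refl3.continuous).cast (refl3_ptP g).symm (refl3_ptP g).symm =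
      ((apprMinus hg (j, true)).trans (hh.map (arcs hg (j, true)).continuous).symm).trans
        (apprPlus hg (j, true)).symm := by
  apply Path.ext
  rw [Path.cast_coe, Path.map_coe]
  funext t
  rw [comp_apply, loopR]
  simp only [Path.trans_apply]
  split_ifs with h₁ h₂
  · exact refl3_approachL hg (-1) 1 (Or.inr rfl) (Or.inl rfl) (by norm_num) _
  · show refl3 (arcs hg (j, true) (hh _)) = arcs hg (j, true) (hh (unitInterval.symm _))
    rw [arcs_true, refl3_arcL_apply]
    congr 1
    exact Subtype.ext (hh_symm_apply _).symm
  · exact refl3_approachL hg 1 (-1) (Or.inl rfl) (Or.inr rfl) (by norm_num) _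

/-- **`σ ∘ loopR b ≃ (loopR b)⁻¹`** (rel endpoints) — as stated, a homotopy of paths in the AMBIENT
`𝔼 3`, where any two paths with equal endpoints are homotopic (`SimplyConnectedSpace.paths_homotopic`,
found by the alias probe, dedup-02444); the contentful statement, in the homotopy quotient of the
sector, is `cl_map_refl3_loopR_true` below (from the path EQUALITY `map_refl3_loopR_true`). Kept as a
deprecated alias; unused in the tree. [folklore] -/
@[deprecated map_refl3_loopR_true (since := "2026-08-16")]
theorem homotopic_map_refl3_loopR_true (hg : 2 ≤ g) (j : Fin 1) :
    (((loopR hg (j, true)).map refl3.continuous).cast (refl3_ptP g).symm (refl3_ptP g).symm).Homotopic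
      (loopR hg (j, true)).symm :=
  SimplyConnectedSpace.paths_homotopic _ _

/-! ### §3 The classes in the homotopy quotient of the sector -/

-- Groupoid bookkeeping (`(γ⁻¹)⁻¹ = γ`, `(γ · γ')⁻¹ = γ'⁻¹ · γ⁻¹` in the homotopy quotient) is
-- `FlowerModel.quot_symm_symm` / `FlowerModel.quot_symm_trans` of `FlowerSectorWord.lean` (§0);
-- the former local restatements `quotient_symm_symm` / `quotient_symm_trans` were removed
-- (dedup-02255 / dedup-02256).

/-- The reflected `b`-loop stays in the sector. [folklore] -/
theorem map_refl3_loopR_mem (hg : 2 ≤ g) (i : surfaceGen 1) (t : I) :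
    ((loopR hg i).map refl3.continuous).cast (refl3_ptP g).symm (refl3_ptP g).symm t ∈ sectorZ g := by
  rw [Path.cast_coe, Path.map_coe, comp_apply]
  exact refl3_mem_sectorZ hg (loopR_mem_sectorZ hg i t)

/-- **In the homotopy quotient of the sector: `[σ ∘ loopR b] = [loopR b]⁻¹`.**
[cite: ZieschangVogtColdewey1980, §3.2] -/
theorem cl_map_refl3_loopR_true (hg : 2 ≤ g) (j : Fin 1) :
    cl (((loopR hg (j, true)).map refl3.continuous).cast (refl3_ptP g).symm (refl3_ptP g).symm)
        (map_refl3_loopR_mem hg (j, true)) =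
      (cl (loopR hg (j, true)) (loopR_mem_sectorZ hg (j, true))).symm := by
  have hM : ∀ t, apprMinus hg (j, true) t ∈ sectorZ g := fun t =>
    tipPatch_subset_sectorZ hg (apprMinus_mem hg (j, true) t)
  have hA : ∀ t, apprPlus hg (j, true) t ∈ sectorZ g := fun t =>
    tipPatch_subset_sectorZ hg (apprPlus_mem hg (j, true) t)
  have hH : ∀ t, hh.map (arcs hg (j, true)).continuous t ∈ sectorZ g := fun t =>
    arcs_mem_sectorZ hg (j, true) _
  rw [cl_congr (map_refl3_loopR_true hg j) _ (VanKampen.trans_mem (VanKampen.trans_mem hM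
      (VanKampen.symm_mem hH)) (VanKampen.symm_mem hA)),
    ← cl_trans _ _ (VanKampen.trans_mem hM (VanKampen.symm_mem hH)) (VanKampen.symm_mem hA),
    ← cl_trans _ _ hM (VanKampen.symm_mem hH), ← cl_symm _ hH, ← cl_symm _ hA]
  rw [cl_congr (show loopR hg (j, true) = ((apprPlus hg (j, true)).trans
        (hh.map (arcs hg (j, true)).continuous)).trans (apprMinus hg (j, true)).symm from rfl)
      (loopR_mem_sectorZ hg (j, true))
      (VanKampen.trans_mem (VanKampen.trans_mem hA hH) (VanKampen.symm_mem hM)),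
    ← cl_trans _ _ (VanKampen.trans_mem hA hH) (VanKampen.symm_mem hM), ← cl_trans _ _ hA hH,
    ← cl_symm _ hM, quot_symm_trans, quot_symm_trans, quot_symm_symm,
    Path.Homotopic.Quotient.trans_assoc]

/-- **In the homotopy quotient of the sector: `[σ ∘ loopR a] = [loopR a]`.**
[cite: ZieschangVogtColdewey1980, §3.2] -/
theorem cl_map_refl3_loopR_false (hg : 2 ≤ g) (j : Fin 1) :
    cl (((loopR hg (j, false)).map refl3.continuous).cast (refl3_ptP g).symm (refl3_ptP g).symm)
        (map_refl3_loopR_mem hg (j, false)) =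
      cl (loopR hg (j, false)) (loopR_mem_sectorZ hg (j, false)) :=
  cl_congr (map_refl3_loopR_false hg j) _ _

end FlowerModel

end Literature.Topology.FourManifolds

end
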